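import Literature.MathematicalPhysics.QuantumLattice.NagaokaTasakiProofs
import Literature.MathematicalPhysics.QuantumLattice.HubbardModelParticleHoleProofs
import Literature.MathematicalPhysics.QuantumLattice.HubbardWave0LiebProofs
import HarnessLib

/-!
# Anderson's doped nearest-neighbour `d`-wave RVB state on the fermionic torus

Trunk `Literature/MathematicalPhysics/QuantumLattice`, family `hubbard`. Definition request
`defn-dopedRVBState` of route `ProjectedBCSGas` (summit `HubbardSuperconductivity`, support item
`DopedRVBPairLRO`, which INLINES the state as a `let`-chain): the Gutzwiller-projected power of
Anderson's nearest-neighbour singlet `d_{x²-y²}` geminal on the torus `(ℤ/Lℤ)²`,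

  `dopedRVBState L N = normalise (P_G · B_d^{⌊N/2⌋} |0⟩)`,
  `B_d = Σ_{x ∼ y} s_d(x, y) c†_{x↑} c†_{y↓}`, `s_d = +1` on bonds along `e₀`, `-1` along `e₁`,

typed over the tree's fermionic Fock space (`Fock`, `creation`, `orb`, `vacuum` of `HubbardWave0`,
`gutzwillerProj` of `NagaokaTasaki`, `FermionTorus`, `fermionTorusGraph` of `HubbardModel`) and
PROPOSITIONALLY (indeed definitionally) EQUAL to the inlined term of
`Summits/HubbardSuperconductivity/HubbardSuperconductivity/Theses/ProjectedBCSGas.lean`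
(`dopedRVBState_eq_inline`, `dopedRVBState_family_eq_inline`, both `rfl`).

## Contents

* `dWaveBondSign`, `rvbGeminal` (`B_d`), `dopedRVBRaw` (`P_G B_d^{⌊N/2⌋} |0⟩`), `dopedRVBState`
  (normalised), with the `rfl` bridges to the route's inlined family.
* Sector API: `B_d^m |0⟩` has `m` up and `m` down electrons (`IsInSector m m`), hence
  `isNParticle_dopedRVBState` (`N` even), `spinZ_mulVec_dopedRVBState` (`S^z χ = 0`),
  `dopedRVBState_mem_szSector` (`χ ∈ szSector N 0`); Gutzwiller API (`isGutzwiller_dopedRVBState`,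
  `gutzwillerProj_mulVec_dopedRVBState`); normalisation (`star_dopedRVBState_dotProduct_self`:
  `⟨χ, χ⟩ = 1` as soon as the raw vector is nonzero; `dopedRVBState_eq_zero_iff`).
* NON-VANISHING (`dopedRVBRaw_ne_zero`, `dopedRVBState_ne_zero`,
  `star_dopedRVBState_dotProduct_self_of_even`): for EVEN `L` and `N ≤ L²` the raw vector is
  nonzero, so the route's `χ_L` is a unit vector. Proof (dimer–monomer configurations, no
  cancellation): a general calculus of geminal powers `(Σ c(x,y) c†_{x↑} c†_{y↓})^k |0⟩` on the
  vacuum is developed first for an arbitrary finite orbital set — pointwise action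
  (`geminalOp_mulVec_apply`), a support principle (`geminalOp_pow_mulVec_vacuum_apply_eq_zero`),
  the Jordan–Wigner sign of a dimer on consecutive sites (`pairCreator_sign_of_covBy`) and the
  exact amplitude `⟨s_A| B^{#A} |0⟩ = (#A)! ∏_{k ∈ A} c_k ε_k` on dimer configurations without cross
  terms (`geminalOp_pow_mulVec_vacuum_dimerConfig`); it is then applied to the reference pattern on
  the even torus whose lines `{(i, ·)}` carry the spin word `↑↓↓↑ ↑↓↓↑ …` and whose dimers are the
  vertical blocks `{(i, 2b), (i, 2b+1)}` (`dimerUp`, `dimerDown`); the only compatible non-dimer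
  ("cross") pairs occur at the wrap-around for `L ≡ 2 (mod 4)` and are killed by the support
  invariant `PatternInv` (`dopedRVB_noCross`).

Not vendored here (further requests of the item, to be filed separately if wanted): Sutherland's
loop-gas formula for `⟨χ, χ⟩` and the site-parity gauge `c_{yσ} ↦ (-1)^{y₂} c_{yσ}` relating the
`d`-wave and extended-`s` nearest-neighbour RVB states (both are statements about this definition,
not part of it).

## Sources

P. W. Anderson, *The resonating valence bond state in La₂CuO₄ and superconductivity*, Science 235
(1987) 1196 (the projected singlet-pair (RVB) state); A. Paramekanti, M. Randeria, N. Trivedi,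
*High-T_c superconductors: a variational theory of the superconducting state*, Phys. Rev. B 70
(2004) 054504 = arXiv:cond-mat/0305611, §IV eqs. (6)–(7) (`|Ψ₀⟩ = P |Ψ_BCS⟩`,
`|Ψ_BCS⟩ = (Σ_k φ(k) c†_{k↑} c†_{-k↓})^{N/2} |0⟩`, real-space pair function `φ(r - r')`,
`P = Π_r (1 - n_{r↑} n_{r↓})`; read 2026-08-15); B. Sutherland, *Systems with
resonating-valence-bond ground states: correlations and excitations*, Phys. Rev. B 37 (1988) 3786
(dimer/valence-bond configurations, norms as loop gases); D. S. Rokhsar, S. A. Kivelson,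
Phys. Rev. Lett. 61 (1988) 2376 (short-range RVB with holes); C. Gros, Ann. Phys. 189 (1989) 53
(Gutzwiller-projected BCS / RVB wavefunctions, the `d`-wave pair function); H. Tasaki, *Physics and
Mathematics of Quantum Many-Body Systems* (2020) §9.2.1 (Jordan–Wigner signs).

## Mathlib / tree search

`lean search 'RVB|geminal|projectedBCS|normalise'`: no RVB or projected-pair state in the tree or
Mathlib; reused: `pairSet`/`upPart`/`downPart`/`IsInSector`/`jwSign_orb_zero`/`jwSign_orb_one`
(`HubbardLiebConfig`), `creation_mulVec_apply` (`HubbardModelParticleHoleProofs`),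
`LiebThm1.spinZ_mulVec_of_isInSector` (`HubbardWave0LiebProofs`), `gutzwillerProj_*`
(`NagaokaTasaki`), `NagaokaTasaki.gutzwillerProj_mulVec_apply` (`NagaokaTasakiProofs`), Mathlib
`dotProduct_star_self_nonneg`/`dotProduct_star_self_pos_iff` (`ℂ` with `ComplexOrder`), `CovBy`,
`ZMod.natCast_eq_natCast_iff'`, `Pi.Lex`, `Subsingleton (DecidableEq _)`.
-/

noncomputable section

namespace Literature.MathematicalPhysics.QuantumLattice

open Matrix Finset HubbardWave0
open scoped ComplexOrder

/-! ### Pair creators `c†_{x↑} c†_{y↓}` on occupation amplitudes and spin sectors -/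

section PairCreator

variable {Λ : Type*} [LinearOrder Λ] [Fintype Λ]

/-- `(c†_{x↑} c†_{y↓} ψ)(s)`: nonzero only if `x↑ ∈ s` and `y↓ ∈ s`, and then a Jordan–Wigner sign
times `ψ (s ∖ {x↑, y↓})`. Tasaki (2020) §9.2.1. [folklore] -/
theorem pairCreator_mulVec_apply (x y : Λ) (ψ : Fock (Orb Λ)) (s : Finset (Orb Λ)) :
    ((creation (orb x 0) * creation (orb y 1)) *ᵥ ψ) s =
      if orb x 0 ∈ s ∧ orb y 1 ∈ s then
        jwSign (orb x 0) (s.erase (orb x 0)) *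
          jwSign (orb y 1) ((s.erase (orb x 0)).erase (orb y 1)) *
            ψ ((s.erase (orb x 0)).erase (orb y 1))
      else 0 := by
  rw [← mulVec_mulVec, creation_mulVec_apply]
  by_cases hx : orb x 0 ∈ s
  · rw [if_pos hx, creation_mulVec_apply]
    have hne : orb y 1 ≠ orb x 0 := by simp [orb]
    by_cases hy : orb y 1 ∈ s
    · rw [if_pos (mem_erase.2 ⟨hne, hy⟩), if_pos ⟨hx, hy⟩, mul_assoc]
    · rw [if_neg (fun h => hy (mem_of_mem_erase h)), if_neg (fun h => hy h.2), mul_zero]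
  · rw [if_neg hx, if_neg (fun h => hx h.1)]

/-- A pair creator raises `N↑` and `N↓` by one each: sector `(a, b)` to `(a + 1, b + 1)`.
Lieb, PRL 62 (1989) 1201, eq. (2). [folklore] -/
theorem IsInSector.pairCreator_mulVec {a b : ℕ} {ψ : Fock (Orb Λ)} (hψ : IsInSector a b ψ)
    (x y : Λ) : IsInSector (a + 1) (b + 1) ((creation (orb x 0) * creation (orb y 1)) *ᵥ ψ) := by
  intro s hs
  rw [pairCreator_mulVec_apply]
  split_ifs with h
  · obtain ⟨hx, hy⟩ := h
    obtain ⟨α, β, rfl⟩ : ∃ α β, s = pairSet α β :=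
      ⟨upPart s, downPart s, (pairSet_upPart_downPart s).symm⟩
    rw [orb_zero_mem_pairSet] at hx
    rw [orb_one_mem_pairSet] at hy
    rw [upPart_pairSet, downPart_pairSet] at hs
    rw [pairSet_erase_zero, pairSet_erase_one, hψ _ ?_, mul_zero]
    rw [upPart_pairSet, downPart_pairSet, card_erase_of_mem hx, card_erase_of_mem hy]
    have ha := card_pos.2 ⟨x, hx⟩
    have hb := card_pos.2 ⟨y, hy⟩
    omega
  · rfl

/-- The vacuum lies in the sector `(0, 0)`. [folklore] -/
theorem IsInSector.vacuum : IsInSector 0 0 (vacuum : Fock (Orb Λ)) := by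
  intro s hs
  rw [QuantumLattice.vacuum, Pi.single_apply, if_neg]
  rintro rfl
  exact hs ⟨by simp [upPart], by simp [downPart]⟩

/-- Finite sums stay in a sector. [folklore] -/
theorem IsInSector.sum {ι : Type*} {S : Finset ι} {f : ι → Fock (Orb Λ)} {a b : ℕ}
    (h : ∀ i ∈ S, IsInSector a b (f i)) : IsInSector a b (∑ i ∈ S, f i) := by
  classical
  induction S using Finset.induction_on with
  | empty => rw [sum_empty]; exact IsInSector.zero a b
  | @insert i S hi ih =>
    rw [sum_insert hi]
    exact (h i (mem_insert_self i S)).add (ih fun j hj => h j (mem_insert_of_mem hj))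

/-- The Gutzwiller projector preserves sectors (it acts pointwise,
`NagaokaTasaki.gutzwillerProj_mulVec_apply`). [folklore] -/
theorem IsInSector.gutzwillerProj_mulVec {a b : ℕ} {ψ : Fock (Orb Λ)} (hψ : IsInSector a b ψ) :
    IsInSector a b (gutzwillerProj *ᵥ ψ) := by
  intro s hs
  rw [NagaokaTasaki.gutzwillerProj_mulVec_apply]
  split_ifs
  · rfl
  · exact hψ s hs

end PairCreator

/-! ### Powers of a general geminal on the vacuum: support and exact amplitudes on dimer
configurations -/

section GeminalPowers

variable {Λ : Type*} [LinearOrder Λ] [Fintype Λ]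

/-- A general (singlet-type) geminal creation operator `B_c = Σ_{x,y} c(x,y) c†_{x↑} c†_{y↓}`.
Yang, Rev. Mod. Phys. 34 (1962) 694, §4 (geminals). [folklore] -/
def geminalOp (c : Λ → Λ → ℂ) : Matrix (Finset (Orb Λ)) (Finset (Orb Λ)) ℂ :=
  ∑ x : Λ, ∑ y : Λ, c x y • (creation (orb x 0) * creation (orb y 1))

/-- Amplitudes of `B_c ψ`. [folklore] -/
theorem geminalOp_mulVec_apply (c : Λ → Λ → ℂ) (ψ : Fock (Orb Λ)) (s : Finset (Orb Λ)) :
    (geminalOp c *ᵥ ψ) s = ∑ x : Λ, ∑ y : Λ, c x y *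
      (if orb x 0 ∈ s ∧ orb y 1 ∈ s then
        jwSign (orb x 0) (s.erase (orb x 0)) *
          jwSign (orb y 1) ((s.erase (orb x 0)).erase (orb y 1)) *
            ψ ((s.erase (orb x 0)).erase (orb y 1))
      else 0) := by
  simp only [geminalOp, sum_mulVec, smul_mulVec, Finset.sum_apply, Pi.smul_apply, smul_eq_mul,
    pairCreator_mulVec_apply]

/-- `B_c` maps the sector `(a, b)` to `(a + 1, b + 1)`. [folklore] -/
theorem IsInSector.geminalOp_mulVec {a b : ℕ} {ψ : Fock (Orb Λ)} (hψ : IsInSector a b ψ)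
    (c : Λ → Λ → ℂ) : IsInSector (a + 1) (b + 1) (geminalOp c *ᵥ ψ) := by
  rw [geminalOp, sum_mulVec]
  refine IsInSector.sum fun x _ => ?_
  rw [sum_mulVec]
  refine IsInSector.sum fun y _ => ?_
  rw [smul_mulVec]
  exact (hψ.pairCreator_mulVec x y).smul _

/-- `B_c^m |0⟩` has `m` up and `m` down electrons. [folklore] -/
theorem isInSector_geminalOp_pow_mulVec_vacuum (c : Λ → Λ → ℂ) (m : ℕ) :
    IsInSector m m (geminalOp c ^ m *ᵥ (vacuum : Fock (Orb Λ))) := by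
  induction m with
  | zero => rw [pow_zero, one_mulVec]; exact IsInSector.vacuum
  | succ m ih =>
    rw [pow_succ', ← mulVec_mulVec]
    exact ih.geminalOp_mulVec c

omit [Fintype Λ] in
/-- Re-inserting an erased pair of distinct orbitals. [folklore] -/
theorem insert_insert_erase_erase_orb {s : Finset (Orb Λ)} {x y : Λ} (hx : orb x 0 ∈ s)
    (hy : orb y 1 ∈ s) :
    insert (orb x 0) (insert (orb y 1) ((s.erase (orb x 0)).erase (orb y 1))) = s := by
  have hne : orb y 1 ≠ orb x 0 := by simp [orb]
  rw [insert_erase (mem_erase.2 ⟨hne, hy⟩), insert_erase hx]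

/-- **Support of geminal powers on the vacuum.** If a property `P` of configurations holds for
`∅` and is stable under adding any pair `{x↑, y↓}` with `c(x,y) ≠ 0`, then `B_c^k |0⟩` is
supported on configurations satisfying `P`. [folklore] -/
theorem geminalOp_pow_mulVec_vacuum_apply_eq_zero (c : Λ → Λ → ℂ) {P : Finset (Orb Λ) → Prop}
    (h0 : P ∅)
    (hstep : ∀ (t : Finset (Orb Λ)) (x y : Λ), P t → c x y ≠ 0 → orb x 0 ∉ t → orb y 1 ∉ t →
      P (insert (orb x 0) (insert (orb y 1) t))) :
    ∀ (k : ℕ) (s : Finset (Orb Λ)), ¬ P s → (geminalOp c ^ k *ᵥ vacuum) s = 0 := by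
  intro k
  induction k with
  | zero =>
    intro s hs
    rw [pow_zero, one_mulVec, QuantumLattice.vacuum, Pi.single_apply, if_neg]
    rintro rfl
    exact hs h0
  | succ k ih =>
    intro s hs
    rw [pow_succ', ← mulVec_mulVec, geminalOp_mulVec_apply]
    refine sum_eq_zero fun x _ => sum_eq_zero fun y _ => ?_
    split_ifs with hmem
    · by_cases hc : c x y = 0
      · rw [hc, zero_mul]
      · have hx' : orb x 0 ∉ (s.erase (orb x 0)).erase (orb y 1) := fun h =>
          (notMem_erase (orb x 0) s) (mem_of_mem_erase h)
        have hy' : orb y 1 ∉ (s.erase (orb x 0)).erase (orb y 1) := notMem_erase _ _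
        have hP : ¬ P ((s.erase (orb x 0)).erase (orb y 1)) := fun hP =>
          hs (insert_insert_erase_erase_orb hmem.1 hmem.2 ▸ hstep _ x y hP hc hx' hy')
        rw [ih _ hP, mul_zero, mul_zero]
    · rw [mul_zero]

/-- **Jordan–Wigner sign of a dimer on consecutive sites.** If `x ∉ β`, `y ∈ β ∖ α` and `x`, `y`
are consecutive in the orbital order (`x ⋖ y` or `y ⋖ x`), the sign picked up by `c†_{x↑} c†_{y↓}`
when completing the configuration `α↑ ∪ β↓` does not depend on the other electrons: it is `+1`
if `x < y` and `-1` if `y < x`. Tasaki (2020) §9.2.1 (Jordan–Wigner signs). [folklore] -/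
theorem pairCreator_sign_of_covBy {α β : Finset Λ} {x y : Λ} (hxβ : x ∉ β) (hyα : y ∉ α)
    (hy : y ∈ β) (hcov : x ⋖ y ∨ y ⋖ x) :
    jwSign (orb x 0) ((pairSet α β).erase (orb x 0)) *
        jwSign (orb y 1) (((pairSet α β).erase (orb x 0)).erase (orb y 1)) =
      if x < y then 1 else -1 := by
  rw [pairSet_erase_zero, pairSet_erase_one, jwSign_orb_zero, jwSign_orb_one]
  rcases hcov with h | h
  · have hxy : x < y := h.lt
    have h1 : (α.erase x).filter (· < x) = (α.erase x).filter (· ≤ y) := by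
      refine filter_congr fun a ha => ?_
      rw [mem_erase] at ha
      constructor
      · exact fun hax => (hax.trans hxy).le
      · intro hay
        have hay' : a < y := lt_of_le_of_ne hay (fun hay'' => hyα (hay'' ▸ ha.2))
        rcases lt_or_ge x a with hxa | hxa
        · exact absurd hay' (h.2 hxa)
        · exact lt_of_le_of_ne hxa ha.1
    have h2 : β.filter (· < x) = (β.erase y).filter (· < y) := by
      ext b
      simp only [mem_filter, mem_erase]
      constructor
      · rintro ⟨hb, hbx⟩
        exact ⟨⟨(hbx.trans hxy).ne, hb⟩, hbx.trans hxy⟩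
      · rintro ⟨⟨hby, hb⟩, hby'⟩
        refine ⟨hb, ?_⟩
        rcases lt_or_ge b x with hbx | hbx
        · exact hbx
        · rcases eq_or_lt_of_le hbx with hbx' | hbx'
          · exact absurd hb (hbx' ▸ hxβ)
          · exact absurd hby' (h.2 hbx')
    have e1 : jwSign x (α.erase x) = leSign y (α.erase x) := by rw [jwSign, leSign, h1]
    have e2 : jwSign x β = jwSign y (β.erase y) := by rw [jwSign, jwSign, h2]
    rw [if_pos hxy, e1, e2, mul_mul_mul_comm, leSign_mul_self, jwSign_mul_self, one_mul]
  · have hyx : y < x := h.lt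
    have h1 : (α.erase x).filter (· < x) = (α.erase x).filter (· ≤ y) := by
      refine filter_congr fun a ha => ?_
      rw [mem_erase] at ha
      constructor
      · intro hax
        rcases lt_or_ge y a with hya | hya
        · exact absurd hax (h.2 hya)
        · exact hya
      · exact fun hay => hay.trans_lt hyx
    have h2 : β.filter (· < x) = insert y ((β.erase y).filter (· < y)) := by
      ext b
      simp only [mem_filter, mem_insert, mem_erase]
      constructor
      · rintro ⟨hb, hbx⟩
        by_cases hby : b = y
        · exact Or.inl hby
        · refine Or.inr ⟨⟨hby, hb⟩, ?_⟩
          rcases lt_or_ge b y with hby' | hby'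
          · exact hby'
          · exact absurd hbx (h.2 (lt_of_le_of_ne hby' (Ne.symm hby)))
      · rintro (rfl | ⟨⟨-, hb⟩, hby'⟩)
        · exact ⟨hy, hyx⟩
        · exact ⟨hb, hby'.trans hyx⟩
    have hnot : y ∉ (β.erase y).filter (· < y) := fun h' => (mem_filter.1 h').2.false
    have e1 : jwSign x (α.erase x) = leSign y (α.erase x) := by rw [jwSign, leSign, h1]
    have e2 : jwSign x β = -jwSign y (β.erase y) := by
      rw [jwSign, jwSign, h2, card_insert_of_notMem hnot, pow_succ, mul_neg_one]
    rw [if_neg (not_lt.2 hyx.le), e1, e2, mul_neg, neg_mul, mul_mul_mul_comm,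
      leSign_mul_self, jwSign_mul_self, one_mul]

/-- `pairSet ∅ ∅ = ∅`. [folklore] -/
theorem pairSet_empty_empty : pairSet (∅ : Finset Λ) ∅ = (∅ : Finset (Orb Λ)) := by
  ext i; simp [mem_pairSet]

variable {κ : Type*}

/-- The dimer configuration `s_A = {u k ↑, v k ↓ | k ∈ A}` of a set `A` of dimers `k`, each
carrying an up electron at `u k` and a down electron at `v k`. Sutherland, PRB 37 (1988) 3786,
§II (dimer/valence-bond configurations). [folklore] -/
def dimerConfig (u v : κ → Λ) (A : Finset κ) : Finset (Orb Λ) :=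
  pairSet (A.image u) (A.image v)

/-- Membership of an up orbital in a dimer configuration. [folklore] -/
theorem orb_zero_mem_dimerConfig {u v : κ → Λ} {A : Finset κ} {x : Λ} :
    orb x 0 ∈ dimerConfig u v A ↔ ∃ k ∈ A, u k = x := by
  rw [dimerConfig, orb_zero_mem_pairSet, mem_image]

/-- Membership of a down orbital in a dimer configuration. [folklore] -/
theorem orb_one_mem_dimerConfig {u v : κ → Λ} {A : Finset κ} {y : Λ} :
    orb y 1 ∈ dimerConfig u v A ↔ ∃ k ∈ A, v k = y := by
  rw [dimerConfig, orb_one_mem_pairSet, mem_image]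

/-- A dimer configuration has no doubly occupied site when no site is both an up end and a down
end of a dimer. [folklore] -/
theorem not_hasDoubleOccupancy_dimerConfig {u v : κ → Λ} (huv : ∀ k k', u k ≠ v k')
    (A : Finset κ) : ¬ HasDoubleOccupancy (dimerConfig u v A) := by
  rintro ⟨x, hx0, hx1⟩
  obtain ⟨k, -, rfl⟩ := orb_zero_mem_dimerConfig.1 hx0
  obtain ⟨k', -, hk'⟩ := orb_one_mem_dimerConfig.1 hx1
  exact huv k k' hk'.symm

variable [DecidableEq κ]

/-- Removing one dimer from a dimer configuration. [folklore] -/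
theorem dimerConfig_erase_erase {u v : κ → Λ} (hu : Function.Injective u)
    (hv : Function.Injective v) {A : Finset κ} {k : κ} :
    ((dimerConfig u v A).erase (orb (u k) 0)).erase (orb (v k) 1) = dimerConfig u v (A.erase k) := by
  rw [dimerConfig, dimerConfig, pairSet_erase_zero, pairSet_erase_one, image_erase hu,
    image_erase hv]

/-- **Exact amplitude of geminal powers on dimer configurations.** Let dimers `k : κ` carry an
up electron at `u k` and a down electron at `v k` (`u`, `v` injective), with `A`-independent
Jordan–Wigner sign `ε k` (hypothesis `hsign`), and suppose that removing from a dimer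
configuration `s_A` any pair `{x↑, y↓}` with `c(x,y) ≠ 0` that is NOT one of its dimers leaves a
configuration outside the support of every `B_c^n |0⟩` (hypothesis `hcross`, "no cross terms").
Then `⟨s_A| B_c^{#A} |0⟩ = (#A)! ∏_{k ∈ A} c(u k, v k) ε k`: only the `(#A)!` orderings of the
dimers of `A` contribute, all with the same sign (pair creators commute). This is the
cancellation-free dimer count behind the non-vanishing of RVB states; Sutherland, PRB 37 (1988)
3786, §II. [folklore] -/
theorem geminalOp_pow_mulVec_vacuum_dimerConfig (c : Λ → Λ → ℂ) {u v : κ → Λ}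
    (hu : Function.Injective u) (hv : Function.Injective v) (ε : κ → ℂ)
    (hsign : ∀ (A : Finset κ) (k : κ), k ∈ A →
      jwSign (orb (u k) 0) ((dimerConfig u v A).erase (orb (u k) 0)) *
        jwSign (orb (v k) 1) (((dimerConfig u v A).erase (orb (u k) 0)).erase (orb (v k) 1)) = ε k)
    (hcross : ∀ (A : Finset κ) (x y : Λ), c x y ≠ 0 → orb x 0 ∈ dimerConfig u v A →
      orb y 1 ∈ dimerConfig u v A → (∀ k ∈ A, u k = x → v k ≠ y) → ∀ n : ℕ,
        (geminalOp c ^ n *ᵥ vacuum) (((dimerConfig u v A).erase (orb x 0)).erase (orb y 1)) = 0)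
    (A : Finset κ) :
    (geminalOp c ^ A.card *ᵥ vacuum) (dimerConfig u v A) =
      (A.card.factorial : ℂ) * ∏ k ∈ A, (c (u k) (v k) * ε k) := by
  suffices h : ∀ (n : ℕ) (A : Finset κ), A.card = n →
      (geminalOp c ^ n *ᵥ vacuum) (dimerConfig u v A) =
        (n.factorial : ℂ) * ∏ k ∈ A, (c (u k) (v k) * ε k) from h _ A rfl
  intro n
  induction n with
  | zero =>
    intro A hA
    rw [card_eq_zero] at hA
    subst hA
    rw [pow_zero, one_mulVec, dimerConfig, image_empty, image_empty, pairSet_empty_empty,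
      prod_empty, Nat.factorial_zero, Nat.cast_one, mul_one]
    rfl
  | succ n ih =>
    intro A hA
    rw [pow_succ', ← mulVec_mulVec, geminalOp_mulVec_apply]
    -- the summand, as a function of the ordered pair `(x, y)`
    set T : Λ → Λ → ℂ := fun x y => c x y *
      (if orb x 0 ∈ dimerConfig u v A ∧ orb y 1 ∈ dimerConfig u v A then
        jwSign (orb x 0) ((dimerConfig u v A).erase (orb x 0)) *
          jwSign (orb y 1) (((dimerConfig u v A).erase (orb x 0)).erase (orb y 1)) *
            (geminalOp c ^ n *ᵥ vacuum) (((dimerConfig u v A).erase (orb x 0)).erase (orb y 1))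
      else 0) with hT
    -- dimer terms
    have hdimer : ∀ k ∈ A, T (u k) (v k) =
        (n.factorial : ℂ) * ((c (u k) (v k) * ε k) * ∏ k' ∈ A.erase k, (c (u k') (v k') * ε k')) := by
      intro k hk
      have hmem : orb (u k) 0 ∈ dimerConfig u v A ∧ orb (v k) 1 ∈ dimerConfig u v A :=
        ⟨orb_zero_mem_dimerConfig.2 ⟨k, hk, rfl⟩, orb_one_mem_dimerConfig.2 ⟨k, hk, rfl⟩⟩
      simp only [hT]
      rw [if_pos hmem, hsign A k hk, dimerConfig_erase_erase hu hv,
        ih (A.erase k) (by rw [card_erase_of_mem hk, hA]; rfl)]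
      ring
    -- cross terms vanish
    have hzero : ∀ x y, (∀ k ∈ A, u k = x → v k ≠ y) → T x y = 0 := by
      intro x y hxy
      simp only [hT]
      split_ifs with hmem
      · by_cases hc : c x y = 0
        · rw [hc, zero_mul]
        · rw [hcross A x y hc hmem.1 hmem.2 hxy n, mul_zero, mul_zero]
      · rw [mul_zero]
    -- reorganise the double sum as a sum over the dimers of `A`
    have hsum : ∑ x : Λ, ∑ y : Λ, T x y = ∑ k ∈ A, T (u k) (v k) := by
      rw [← Fintype.sum_prod_type']
      have himage : ∑ k ∈ A, T (u k) (v k) = ∑ p ∈ A.image (fun k => (u k, v k)), T p.1 p.2 := by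
        rw [sum_image]
        intro k _ k' _ h
        exact hu (Prod.ext_iff.1 h).1
      rw [himage]
      symm
      refine sum_subset (subset_univ _) fun p _ hp => hzero p.1 p.2 fun k hk hku hkv => hp ?_
      exact mem_image.2 ⟨k, hk, Prod.ext hku hkv⟩
    show ∑ x : Λ, ∑ y : Λ, T x y = _
    rw [hsum, sum_congr rfl hdimer, ← mul_sum]
    rw [sum_congr rfl fun k hk => mul_prod_erase A (fun k' => c (u k') (v k') * ε k') hk,
      sum_const, nsmul_eq_mul, hA, Nat.factorial_succ, Nat.cast_mul]
    ring

/-- **Non-vanishing of Gutzwiller-projected geminal powers.** Under the hypotheses of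
`geminalOp_pow_mulVec_vacuum_dimerConfig`, with non-vanishing bond coefficients and signs on
the dimers and no site serving both as an up end and a down end, `P_G B_c^m |0⟩ ≠ 0` for every
`m` not exceeding the number of available dimers. Sutherland, PRB 37 (1988) 3786, §II. [folklore] -/
theorem gutzwillerProj_geminalOp_pow_mulVec_vacuum_ne_zero [Fintype κ] (c : Λ → Λ → ℂ)
    {u v : κ → Λ} (hu : Function.Injective u) (hv : Function.Injective v)
    (huv : ∀ k k', u k ≠ v k') (ε : κ → ℂ)
    (hsign : ∀ (A : Finset κ) (k : κ), k ∈ A →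
      jwSign (orb (u k) 0) ((dimerConfig u v A).erase (orb (u k) 0)) *
        jwSign (orb (v k) 1) (((dimerConfig u v A).erase (orb (u k) 0)).erase (orb (v k) 1)) = ε k)
    (hcross : ∀ (A : Finset κ) (x y : Λ), c x y ≠ 0 → orb x 0 ∈ dimerConfig u v A →
      orb y 1 ∈ dimerConfig u v A → (∀ k ∈ A, u k = x → v k ≠ y) → ∀ n : ℕ,
        (geminalOp c ^ n *ᵥ vacuum) (((dimerConfig u v A).erase (orb x 0)).erase (orb y 1)) = 0)
    (hc : ∀ k, c (u k) (v k) ≠ 0) (hε : ∀ k, ε k ≠ 0) {m : ℕ} (hm : m ≤ Fintype.card κ) :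
    gutzwillerProj *ᵥ (geminalOp c ^ m *ᵥ (vacuum : Fock (Orb Λ))) ≠ 0 := by
  obtain ⟨A, hA⟩ := powersetCard_nonempty.2 (show m ≤ (univ : Finset κ).card by rwa [card_univ])
  have hAm : A.card = m := (mem_powersetCard.1 hA).2
  intro h0
  have h := congrFun h0 (dimerConfig u v A)
  rw [Pi.zero_apply, NagaokaTasaki.gutzwillerProj_mulVec_apply,
    if_neg (not_hasDoubleOccupancy_dimerConfig huv A), ← hAm,
    geminalOp_pow_mulVec_vacuum_dimerConfig c hu hv ε hsign hcross A] at h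
  refine mul_ne_zero (Nat.cast_ne_zero.2 (Nat.factorial_ne_zero _)) ?_ h
  exact prod_ne_zero_iff.2 fun k _ => mul_ne_zero (hc k) (hε k)

/-- Matrix powers do not depend on the `DecidableEq` instance on the index type used to build the
matrix semiring (all such instances are equal). Technical bridge between the two elaborations of
`B^k` that occur for the fermionic torus (linear-order versus pointwise decidable equality of
sites). [folklore] -/
theorem pow_decEq_irrel {n : Type*} [Fintype n] (d₁ d₂ : DecidableEq n) (M : Matrix n n ℂ)
    (k : ℕ) : (letI : DecidableEq n := d₁; M ^ k) = (letI : DecidableEq n := d₂; M ^ k) := by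
  obtain rfl : d₁ = d₂ := Subsingleton.elim _ _
  rfl

end GeminalPowers

/-! ### Coordinates, order and adjacency on the fermionic torus `(ℤ/Lℤ)²` -/

namespace FermionTorus

variable {L : ℕ}

/-- The site `(i, j)` of the fermionic torus `(ℤ/Lℤ)²` (`i` = coordinate `0`, `j` = coordinate
`1`). Friedli–Velenik (2017) §3.1. [folklore] -/
def site (i j : Fin L) : FermionTorus 2 L := toLex ![i, j]

/-- First coordinate of `site i j`. [folklore] -/
@[simp] theorem ofLex_site_zero (i j : Fin L) : ofLex (site i j) 0 = i := rfl

/-- Second coordinate of `site i j`. [folklore] -/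
@[simp] theorem ofLex_site_one (i j : Fin L) : ofLex (site i j) 1 = j := rfl

/-- Every site is `site i j` of its coordinates. [folklore] -/
theorem site_ofLex (x : FermionTorus 2 L) : site (ofLex x 0) (ofLex x 1) = x := by
  refine (congrArg toLex ?_).trans (toLex_ofLex x)
  funext k
  fin_cases k <;> rfl

/-- Sites are determined by their two coordinates. [folklore] -/
theorem ext₂ {x y : FermionTorus 2 L} (h0 : ofLex x 0 = ofLex y 0) (h1 : ofLex x 1 = ofLex y 1) :
    x = y := by
  rw [← site_ofLex x, ← site_ofLex y, h0, h1]

/-- First coordinate of `site i j` (`simp`-normal form, after `Pi.ofLex_apply`). [folklore] -/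
@[simp] theorem site_apply_zero (i j : Fin L) : site i j 0 = i := rfl

/-- Second coordinate of `site i j` (`simp`-normal form). [folklore] -/
@[simp] theorem site_apply_one (i j : Fin L) : site i j 1 = j := rfl

/-- `site` is injective. [folklore] -/
theorem site_inj {i j i' j' : Fin L} : site i j = site i' j' ↔ i = i' ∧ j = j' :=
  ⟨fun h => ⟨by simpa only [ofLex_site_zero] using congrArg (fun x : FermionTorus 2 L => ofLex x 0) h,
    by simpa only [ofLex_site_one] using congrArg (fun x : FermionTorus 2 L => ofLex x 1) h⟩,
    fun ⟨h0, h1⟩ => by rw [h0, h1]⟩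

/-- The lexicographic order of `FermionTorus 2 L` in coordinates. Tasaki (2020) §9.2.1 (ordering
of the sites in the Jordan–Wigner construction). [folklore] -/
theorem toLex_lt_toLex_iff₂ {x y : Fin 2 → Fin L} :
    (toLex x : FermionTorus 2 L) < toLex y ↔ x 0 < y 0 ∨ (x 0 = y 0 ∧ x 1 < y 1) := by
  have h : (toLex x : FermionTorus 2 L) < toLex y ↔ Pi.Lex (· < ·) (· < ·) x y := Iff.rfl
  rw [h]
  simp only [Pi.Lex, Fin.exists_fin_two, Fin.forall_fin_two]
  simp

/-- The lexicographic order of sites in coordinates. [folklore] -/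
theorem site_lt_site_iff {i j i' j' : Fin L} :
    site i j < site i' j' ↔ i < i' ∨ (i = i' ∧ j < j') := by
  rw [site, site, toLex_lt_toLex_iff₂]
  simp

/-- `(i, j)` and `(i, j + 1)` are consecutive in the orbital order of sites. [folklore] -/
theorem site_covBy_site {i j j' : Fin L} (h : (j' : ℕ) = j + 1) : site i j ⋖ site i j' := by
  refine ⟨site_lt_site_iff.2 (Or.inr ⟨rfl, Fin.lt_def.2 (by omega)⟩), fun z hz hz' => ?_⟩
  rw [← site_ofLex z] at hz hz'
  rcases site_lt_site_iff.1 hz with h1 | ⟨h1, h2⟩ <;>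
    rcases site_lt_site_iff.1 hz' with h3 | ⟨h3, h4⟩
  · exact absurd (h1.trans h3) (lt_irrefl _)
  · rw [h3] at h1
    exact absurd h1 (lt_irrefl _)
  · rw [← h1] at h3
    exact absurd h3 (lt_irrefl _)
  · have h2' := Fin.lt_def.1 h2
    have h4' := Fin.lt_def.1 h4
    omega

/-- Coordinates in `Fin L` with equal images in `ZMod L` are equal. [folklore] -/
theorem fin_eq_of_natCast_eq {a b : Fin L} (h : ((a : ℕ) : ZMod L) = ((b : ℕ) : ZMod L)) :
    a = b := by
  have h' := (ZMod.natCast_eq_natCast_iff' a b L).1 h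
  rw [Nat.mod_eq_of_lt a.isLt, Nat.mod_eq_of_lt b.isLt] at h'
  exact Fin.ext h'

/-- `b = a + 1` in `ZMod L` for coordinates `a, b ∈ Fin L` means `b = (a + 1) mod L`. [folklore] -/
theorem val_eq_of_natCast_eq_add_one {a b : Fin L}
    (h : ((b : ℕ) : ZMod L) = ((a : ℕ) : ZMod L) + 1) : (b : ℕ) = ((a : ℕ) + 1) % L := by
  have h' : ((b : ℕ) : ZMod L) = (((a : ℕ) + 1 : ℕ) : ZMod L) := by rw [h]; push_cast; ring
  have h'' := (ZMod.natCast_eq_natCast_iff' b (a + 1) L).1 h'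
  rwa [Nat.mod_eq_of_lt b.isLt] at h''

/-- **Adjacency on the torus in coordinates** (necessary condition): two adjacent sites either
have equal second coordinates (a bond along `e₀`) or equal first coordinates and second
coordinates differing by `±1 mod L` (a bond along `e₁`). Friedli–Velenik (2017) §3.1. [folklore] -/
theorem adj_site_cases {i j i' j' : Fin L} (h : (fermionTorusGraph 2 L).Adj (site i j) (site i' j')) :
    j = j' ∨ (i = i' ∧ ((j' : ℕ) = ((j : ℕ) + 1) % L ∨ (j : ℕ) = ((j' : ℕ) + 1) % L)) := by
  rw [fermionTorusGraph_adj, Literature.Probability.LatticeModels.torusGraph_adj_iff] at h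
  obtain ⟨-, ⟨k, hk⟩ | ⟨k, hk⟩⟩ := h
  · have h0 := congrFun hk 0
    have h1 := congrFun hk 1
    fin_cases k
    · left
      simp only [toTorusSite_apply, Pi.add_apply] at h1
      simp [site] at h1
      exact (fin_eq_of_natCast_eq h1).symm
    · right
      simp only [toTorusSite_apply, Pi.add_apply] at h0 h1
      simp [site] at h0 h1
      exact ⟨(fin_eq_of_natCast_eq h0).symm, Or.inl (val_eq_of_natCast_eq_add_one h1)⟩
  · have h0 := congrFun hk 0
    have h1 := congrFun hk 1
    fin_cases k
    · left
      simp only [toTorusSite_apply, Pi.add_apply] at h1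
      simp [site] at h1
      exact fin_eq_of_natCast_eq h1
    · right
      simp only [toTorusSite_apply, Pi.add_apply] at h0 h1
      simp [site] at h0 h1
      exact ⟨fin_eq_of_natCast_eq h0, Or.inr (val_eq_of_natCast_eq_add_one h1)⟩

/-- `(i, j)` and `(i, j + 1)` are nearest neighbours on the torus (a bond along `e₁`).
Friedli–Velenik (2017) §3.1. [folklore] -/
theorem adj_site_succ {i j j' : Fin L} (h : (j' : ℕ) = (j : ℕ) + 1) :
    (fermionTorusGraph 2 L).Adj (site i j) (site i j') := by
  rw [fermionTorusGraph_adj, Literature.Probability.LatticeModels.torusGraph_adj_iff]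
  refine ⟨fun heq => ?_, Or.inl ⟨1, ?_⟩⟩
  · have h1 := congrFun heq 1
    simp only [toTorusSite_apply] at h1
    simp [site] at h1
    have := congrArg Fin.val (fin_eq_of_natCast_eq h1)
    omega
  · funext k
    fin_cases k
    · simp [site, toTorusSite_apply]
    · simp [site, toTorusSite_apply, h]

end FermionTorus

/-! ### The `d`-wave bond sign, Anderson's geminal and the doped RVB state -/

/-- The `d_{x²-y²}` bond sign `s_d(x, y)` on the fermionic torus `(ℤ/Lℤ)²`, for an ORDERED pair of
sites: `+1` if `x ∼ y` along `e₀` (second coordinates equal), `-1` if `x ∼ y` along `e₁`, `0` if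
`x`, `y` are not nearest neighbours (the nearest-neighbour restriction of the tree's
`dWaveFormFactor`). Scalapino, Phys. Rep. 250 (1995) 329, §2 eq. (2.3).
[cite: Scalapino1995, §2 eq. (2.3)] -/
def dWaveBondSign (L : ℕ) (x y : FermionTorus 2 L) : ℂ :=
  if (fermionTorusGraph 2 L).Adj x y then
    (if (ofLex x 1 : ℕ) = (ofLex y 1 : ℕ) then (1 : ℂ) else -1)
  else 0

/-- **Anderson's nearest-neighbour singlet `d`-wave geminal**
`B_d = Σ_{x, y} s_d(x, y) c†_{x↑} c†_{y↓}` (sum over ordered pairs, so every bond `{x, y}`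
contributes the singlet combination `s_d (c†_{x↑} c†_{y↓} + c†_{y↑} c†_{x↓})
= s_d (c†_{x↑} c†_{y↓} - c†_{x↓} c†_{y↑})`): the pair creator `Σ_{r,r'} φ(r - r') c†_{r↑} c†_{r'↓}`
of the (projected) BCS / RVB wavefunction with the nearest-neighbour `d`-wave pair function
`φ = s_d`. Anderson, Science 235 (1987) 1196 (RVB as a projected singlet-pair state);
Paramekanti–Randeria–Trivedi, PRB 70 (2004) 054504, §IV eqs. (6)–(7) (pair wavefunction `φ`);
Gros, Ann. Phys. 189 (1989) 53. [cite: Anderson1987] [cite: ParamekantiRanderiaTrivedi2004, §IV eqs. (6)–(7)] -/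
def rvbGeminal (L : ℕ) :
    Matrix (Finset (Orb (FermionTorus 2 L))) (Finset (Orb (FermionTorus 2 L))) ℂ :=
  geminalOp (dWaveBondSign L)

/-- `rvbGeminal` unfolded. [folklore] -/
theorem rvbGeminal_eq_sum (L : ℕ) :
    rvbGeminal L = ∑ x : FermionTorus 2 L, ∑ y : FermionTorus 2 L,
      dWaveBondSign L x y • (creation (orb x 0) * creation (orb y 1)) := rfl

/-- The UNNORMALISED doped nearest-neighbour `d`-wave RVB vector with `N` electrons (`⌊N/2⌋`
singlet pairs) on the torus `(ℤ/Lℤ)²`: `P_G B_d^{⌊N/2⌋} |0⟩`, the Gutzwiller projection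
`P_G = Π_r (1 - n_{r↑} n_{r↓})` of the `⌊N/2⌋`-th power of Anderson's geminal on the vacuum
("doped": `L² - N` empty sites = holes), i.e. `P |Ψ_BCS⟩` with
`|Ψ_BCS⟩ = (Σ φ c†_↑ c†_↓)^{N/2} |0⟩` for the nearest-neighbour `d`-wave `φ`. Anderson, Science 235
(1987) 1196; Paramekanti–Randeria–Trivedi, PRB 70 (2004) 054504, §IV eqs. (6)–(7); Rokhsar–Kivelson,
PRL 61 (1988) 2376 (short-range RVB with holes).
[cite: Anderson1987] [cite: ParamekantiRanderiaTrivedi2004, §IV eqs. (6)–(7)] -/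
def dopedRVBRaw (L N : ℕ) : Fock (Orb (FermionTorus 2 L)) :=
  gutzwillerProj *ᵥ (rvbGeminal L ^ (N / 2) *ᵥ vacuum)

/-- **Anderson's doped nearest-neighbour `d`-wave RVB state** `χ^{RVB}_{L,N}` on the fermionic
torus `(ℤ/Lℤ)²`: the normalisation `‖raw‖⁻¹ • raw` of `raw = P_G B_d^{⌊N/2⌋} |0⟩`
(`dopedRVBRaw`), with the tree's convention `‖ψ‖ = √(re ⟨ψ, ψ⟩)`, `⟨ψ, ψ⟩ = star ψ ⬝ᵥ ψ`; it is
the zero vector iff `raw = 0` (`dopedRVBState_eq_zero_iff`), which does not happen for even `L`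
and `N ≤ L²` (`dopedRVBState_ne_zero`). This is, verbatim, the trial family `χ` inlined in the
route item `DopedRVBPairLRO` of `Summits/HubbardSuperconductivity/…/Theses/ProjectedBCSGas.lean`
(see `dopedRVBState_family_eq_inline`); it is the `μ → -∞` (short-range) member of the
Gutzwiller-projected BCS family. Anderson, Science 235 (1987) 1196; Paramekanti–Randeria–Trivedi,
PRB 70 (2004) 054504, §IV eqs. (6)–(7); Gros, Ann. Phys. 189 (1989) 53; Sutherland, PRB 37 (1988)
3786. [cite: Anderson1987] [cite: ParamekantiRanderiaTrivedi2004, §IV eqs. (6)–(7)] -/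
def dopedRVBState (L N : ℕ) : Fock (Orb (FermionTorus 2 L)) :=
  (((Real.sqrt ((star (dopedRVBRaw L N) ⬝ᵥ dopedRVBRaw L N).re))⁻¹ : ℝ) : ℂ) • dopedRVBRaw L N

/-- **Bridge to the route's inlined term** (definitional): `dopedRVBState L N` is, by `rfl`, the
`let`-chain written in `DopedRVBPairLRO` with the particle number `N` abstracted. [folklore] -/
theorem dopedRVBState_eq_inline (L N : ℕ) :
    dopedRVBState L N =
      (let B : Matrix (Finset (Orb (FermionTorus 2 L))) (Finset (Orb (FermionTorus 2 L))) ℂ :=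
        ∑ x : FermionTorus 2 L, ∑ y : FermionTorus 2 L,
          (if (fermionTorusGraph 2 L).Adj x y then
              (if (ofLex x 1 : ℕ) = (ofLex y 1 : ℕ) then (1 : ℂ) else -1) else 0) •
            (creation (orb x 0) * creation (orb y 1))
      let raw : Fock (Orb (FermionTorus 2 L)) := gutzwillerProj *ᵥ (B ^ (N / 2) *ᵥ vacuum)
      (((Real.sqrt ((star raw ⬝ᵥ raw).re))⁻¹ : ℝ) : ℂ) • raw) :=
  rfl

/-- **Bridge, family form**: the family `L ↦ dopedRVBState L (2⌊(1-δ)L²/2⌋)` is, by `rfl`, the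
trial family `χ` of `DopedRVBPairLRO` (copied verbatim), so that the route item restates
definitionally over this name. [folklore] -/
theorem dopedRVBState_family_eq_inline (δ : ℝ) :
    (fun L : ℕ => dopedRVBState L (2 * ⌊(1 - δ) * (L : ℝ) ^ 2 / 2⌋₊)) =
      (fun L : ℕ => let N : ℕ := 2 * ⌊(1 - δ) * (L : ℝ) ^ 2 / 2⌋₊; let B : Matrix (Finset (Orb (FermionTorus 2 L))) (Finset (Orb (FermionTorus 2 L))) ℂ := ∑ x : FermionTorus 2 L, ∑ y : FermionTorus 2 L, (if (fermionTorusGraph 2 L).Adj x y then (if (ofLex x 1 : ℕ) = (ofLex y 1 : ℕ) then (1 : ℂ) else -1) else 0) • (creation (orb x 0) * creation (orb y 1)); let raw : Fock (Orb (FermionTorus 2 L)) := gutzwillerProj *ᵥ (B ^ (N / 2) *ᵥ vacuum); (((Real.sqrt ((star raw ⬝ᵥ raw).re))⁻¹ : ℝ) : ℂ) • raw) :=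
  rfl

/-! ### Sector, Gutzwiller and normalisation API -/

/-- `B_d^m |0⟩` has `m` up and `m` down electrons. (Proved by induction rather than from
`isInSector_geminalOp_pow_mulVec_vacuum`: outside the section `TorusPattern` below, matrix powers
over the torus elaborate with the pointwise `DecidableEq` instance on sites, as in the route file,
not the linear-order one of the orbital-generic lemmas.) [folklore] -/
theorem isInSector_rvbGeminal_pow_mulVec_vacuum (L m : ℕ) :
    IsInSector m m (rvbGeminal L ^ m *ᵥ (vacuum : Fock (Orb (FermionTorus 2 L)))) := by
  induction m with
  | zero => rw [pow_zero, one_mulVec]; exact IsInSector.vacuum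
  | succ m ih =>
    rw [pow_succ', ← mulVec_mulVec]
    exact ih.geminalOp_mulVec (dWaveBondSign L)

/-- The unnormalised doped RVB vector lies in the sector `(⌊N/2⌋, ⌊N/2⌋)`. [folklore] -/
theorem isInSector_dopedRVBRaw (L N : ℕ) : IsInSector (N / 2) (N / 2) (dopedRVBRaw L N) :=
  (isInSector_rvbGeminal_pow_mulVec_vacuum L (N / 2)).gutzwillerProj_mulVec

/-- The doped RVB state lies in the sector `(⌊N/2⌋, ⌊N/2⌋)`. [folklore] -/
theorem isInSector_dopedRVBState (L N : ℕ) : IsInSector (N / 2) (N / 2) (dopedRVBState L N) :=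
  (isInSector_dopedRVBRaw L N).smul _

/-- For even `N`, the doped RVB state is an `N`-particle vector. [folklore] -/
theorem isNParticle_dopedRVBState {L N : ℕ} (hN : Even N) : IsNParticle N (dopedRVBState L N) := by
  have h := (isInSector_dopedRVBState L N).isNParticle
  rwa [← two_mul, Nat.mul_div_cancel' hN.two_dvd] at h

/-- The doped RVB state has `S^z = 0`: `S^z χ = 0` (equal numbers of up and down electrons).
Anderson, Science 235 (1987) 1196 (singlet pairs). [folklore] -/
theorem spinZ_mulVec_dopedRVBState (L N : ℕ) :
    HubbardWave0.spinZ *ᵥ dopedRVBState L N = 0 := by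
  rw [LiebThm1.spinZ_mulVec_of_isInSector (isInSector_dopedRVBState L N), sub_self, mul_zero,
    zero_smul]

/-- For even `N`, the doped RVB state lies in the joint sector `(N, S^z = 0)` of `szSector`
(the sector of the summit statement `HubbardSuperconductivity`). [folklore] -/
theorem dopedRVBState_mem_szSector {L N : ℕ} (hN : Even N) :
    dopedRVBState L N ∈ szSector N 0 := by
  rw [mem_szSector_iff]
  refine ⟨isNParticle_dopedRVBState hN, ?_⟩
  rw [spinZ_mulVec_dopedRVBState, Complex.ofReal_zero, zero_smul]

/-- The unnormalised doped RVB vector obeys the Gutzwiller constraint. [folklore] -/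
theorem isGutzwiller_dopedRVBRaw (L N : ℕ) : IsGutzwiller (dopedRVBRaw L N) := by
  rw [← gutzwillerProj_mulVec_eq_self_iff, dopedRVBRaw, mulVec_mulVec, gutzwillerProj_mul_self]

/-- The doped RVB state obeys the Gutzwiller constraint (no doubly occupied site: it is a state of
the `U = ∞` / `t`-`J` Hilbert space). Anderson, Science 235 (1987) 1196, eq. (3). [folklore] -/
theorem isGutzwiller_dopedRVBState (L N : ℕ) : IsGutzwiller (dopedRVBState L N) :=
  fun s hs => by rw [dopedRVBState, Pi.smul_apply, isGutzwiller_dopedRVBRaw L N s hs, smul_zero]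

/-- `P_G χ = χ`. [folklore] -/
theorem gutzwillerProj_mulVec_dopedRVBState (L N : ℕ) :
    gutzwillerProj *ᵥ dopedRVBState L N = dopedRVBState L N :=
  (gutzwillerProj_mulVec_eq_self_iff _).2 (isGutzwiller_dopedRVBState L N)

/-- The squared norm `⟨raw, raw⟩` is the real number `re ⟨raw, raw⟩ (≥ 0)`. [folklore] -/
theorem star_dopedRVBRaw_dotProduct_self (L N : ℕ) :
    star (dopedRVBRaw L N) ⬝ᵥ dopedRVBRaw L N =
      (((star (dopedRVBRaw L N) ⬝ᵥ dopedRVBRaw L N).re : ℝ) : ℂ) := by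
  obtain ⟨-, h2⟩ := Complex.nonneg_iff.1 (dotProduct_star_self_nonneg (dopedRVBRaw L N))
  exact Complex.ext (by simp) (by simp [h2])

/-- **Normalisation**: if the unnormalised vector is nonzero, the doped RVB state is a unit
vector, `⟨χ, χ⟩ = 1`. [folklore] -/
theorem star_dopedRVBState_dotProduct_self {L N : ℕ} (h : dopedRVBRaw L N ≠ 0) :
    star (dopedRVBState L N) ⬝ᵥ dopedRVBState L N = 1 := by
  have hre := star_dopedRVBRaw_dotProduct_self L N
  have hpos := (Complex.pos_iff.1 (dotProduct_star_self_pos_iff.2 h)).1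
  set q : ℝ := (star (dopedRVBRaw L N) ⬝ᵥ dopedRVBRaw L N).re with hq
  unfold dopedRVBState
  rw [← hq, star_smul, smul_dotProduct, dotProduct_smul, hre, smul_smul, smul_eq_mul,
    Complex.star_def, Complex.conj_ofReal, ← Complex.ofReal_mul, ← Complex.ofReal_mul, ← mul_inv,
    Real.mul_self_sqrt hpos.le, inv_mul_cancel₀ hpos.ne', Complex.ofReal_one]

/-- The doped RVB state vanishes exactly when the unnormalised vector does. [folklore] -/
theorem dopedRVBState_eq_zero_iff (L N : ℕ) : dopedRVBState L N = 0 ↔ dopedRVBRaw L N = 0 := by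
  constructor
  · intro h
    by_contra hne
    have := star_dopedRVBState_dotProduct_self hne
    rw [h, dotProduct_zero] at this
    exact zero_ne_one this
  · intro h
    rw [dopedRVBState, h, smul_zero]

/-! ### The reference dimer pattern on the even torus and non-vanishing -/

section TorusPattern

open FermionTorus

variable {L : ℕ}

/-- (Local to this section.) Equality of torus sites is decided through the LINEAR ORDER, exactly
as in the orbital-generic lemmas above (which only know `[LinearOrder Λ]`): the global instance
for `Lex (Fin 2 → Fin L)` is the pointwise one, which is propositionally but not definitionally
equal, and would make `Finset.erase`/`insert`/`image` on torus configurations and the matrix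
powers `B^k` (whose semiring structure uses `DecidableEq (Finset (Orb Λ))`) elaborate differently
from those lemmas. The definitions `rvbGeminal`, `dopedRVBRaw`, `dopedRVBState` above are
deliberately OUTSIDE this section, so that they elaborate like the route's inlined term; the single
bridge is `dopedRVBRaw_eq_pow`. [folklore] -/
local instance (priority := high) instDecidableEqFermionTorus₂ : DecidableEq (FermionTorus 2 L) :=
  LinearOrder.toDecidableEq

/-- Bridge between the two elaborations of the matrix power: `dopedRVBRaw L N` (defined with the
global instances) equals `P_G B_d^{⌊N/2⌋} |0⟩` as elaborated in this section. [folklore] -/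
theorem dopedRVBRaw_eq_pow (L N : ℕ) :
    dopedRVBRaw L N = gutzwillerProj *ᵥ (rvbGeminal L ^ (N / 2) *ᵥ vacuum) :=
  congrArg (fun M => gutzwillerProj *ᵥ (M *ᵥ vacuum)) (pow_decEq_irrel _ _ (rvbGeminal L) (N / 2))

/-- A nonzero `d`-wave bond sign forces adjacency. [folklore] -/
theorem adj_of_dWaveBondSign_ne_zero {x y : FermionTorus 2 L} (h : dWaveBondSign L x y ≠ 0) :
    (fermionTorusGraph 2 L).Adj x y := by
  by_contra h'
  exact h (by rw [dWaveBondSign, if_neg h'])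

/-- The spin carried by the line coordinate `j` in the reference pattern: `↑` (`0`) iff
`j mod 4 ∈ {0, 3}`, `↓` (`1`) iff `j mod 4 ∈ {1, 2}` (the word `↑↓↓↑ ↑↓↓↑ …` along `e₁`). [folklore] -/
def patternSpin (j : ℕ) : Fin 2 := if j % 4 = 0 ∨ j % 4 = 3 then 0 else 1

/-- The up end `2b` (`b` even) / `2b + 1` (`b` odd) of the block `{2b, 2b+1}` of a line. [folklore] -/
def upCoord (b : Fin (L / 2)) : Fin L :=
  ⟨if (b : ℕ) % 2 = 0 then 2 * (b : ℕ) else 2 * (b : ℕ) + 1,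
    by have := b.isLt; split_ifs <;> omega⟩

/-- The down end `2b + 1` (`b` even) / `2b` (`b` odd) of the block `{2b, 2b+1}` of a line. [folklore] -/
def downCoord (b : Fin (L / 2)) : Fin L :=
  ⟨if (b : ℕ) % 2 = 0 then 2 * (b : ℕ) + 1 else 2 * (b : ℕ),
    by have := b.isLt; split_ifs <;> omega⟩

/-- Value of `upCoord`. [folklore] -/
theorem val_upCoord (b : Fin (L / 2)) :
    (upCoord b : ℕ) = if (b : ℕ) % 2 = 0 then 2 * (b : ℕ) else 2 * (b : ℕ) + 1 := rfl

/-- Value of `downCoord`. [folklore] -/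
theorem val_downCoord (b : Fin (L / 2)) :
    (downCoord b : ℕ) = if (b : ℕ) % 2 = 0 then 2 * (b : ℕ) + 1 else 2 * (b : ℕ) := rfl

/-- `upCoord b mod 4 ∈ {0, 3}`. [folklore] -/
theorem val_upCoord_mod_four (b : Fin (L / 2)) :
    (upCoord b : ℕ) % 4 = 0 ∨ (upCoord b : ℕ) % 4 = 3 := by
  rw [val_upCoord]; split_ifs <;> omega

/-- `downCoord b mod 4 ∈ {1, 2}`. [folklore] -/
theorem val_downCoord_mod_four (b : Fin (L / 2)) :
    (downCoord b : ℕ) % 4 = 1 ∨ (downCoord b : ℕ) % 4 = 2 := by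
  rw [val_downCoord]; split_ifs <;> omega

/-- The pattern spin at an up end is `↑`. [folklore] -/
theorem patternSpin_upCoord (b : Fin (L / 2)) : patternSpin (upCoord b : ℕ) = 0 := by
  rw [patternSpin, if_pos (val_upCoord_mod_four b)]

/-- The pattern spin at a down end is `↓`. [folklore] -/
theorem patternSpin_downCoord (b : Fin (L / 2)) : patternSpin (downCoord b : ℕ) = 1 := by
  rw [patternSpin, if_neg]
  rcases val_downCoord_mod_four b with h | h <;> omega

/-- The block index is recovered from either end: `⌊upCoord b / 2⌋ = b`. [folklore] -/
theorem val_upCoord_div_two (b : Fin (L / 2)) : (upCoord b : ℕ) / 2 = b := by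
  rw [val_upCoord]; split_ifs <;> omega

/-- `⌊downCoord b / 2⌋ = b`. [folklore] -/
theorem val_downCoord_div_two (b : Fin (L / 2)) : (downCoord b : ℕ) / 2 = b := by
  rw [val_downCoord]; split_ifs <;> omega

/-- The up end `(i, upCoord b)` of the dimer `(i, b)` (line `i`, block `b`). [folklore] -/
def dimerUp (k : Fin L × Fin (L / 2)) : FermionTorus 2 L := site k.1 (upCoord k.2)

/-- The down end `(i, downCoord b)` of the dimer `(i, b)`. [folklore] -/
def dimerDown (k : Fin L × Fin (L / 2)) : FermionTorus 2 L := site k.1 (downCoord k.2)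

/-- `dimerUp` is injective. [folklore] -/
theorem dimerUp_injective : Function.Injective (dimerUp (L := L)) := by
  rintro ⟨i, b⟩ ⟨i', b'⟩ h
  obtain ⟨h0, h1⟩ := site_inj.1 h
  have h1' := congrArg (fun j : Fin L => (j : ℕ) / 2) h1
  simp only [val_upCoord_div_two] at h1'
  exact Prod.ext h0 (Fin.ext h1')

/-- `dimerDown` is injective. [folklore] -/
theorem dimerDown_injective : Function.Injective (dimerDown (L := L)) := by
  rintro ⟨i, b⟩ ⟨i', b'⟩ h
  obtain ⟨h0, h1⟩ := site_inj.1 h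
  have h1' := congrArg (fun j : Fin L => (j : ℕ) / 2) h1
  simp only [val_downCoord_div_two] at h1'
  exact Prod.ext h0 (Fin.ext h1')

/-- No site is both an up end and a down end (every site of the pattern carries one spin). [folklore] -/
theorem dimerUp_ne_dimerDown (k k' : Fin L × Fin (L / 2)) : dimerUp k ≠ dimerDown k' := by
  intro h
  obtain ⟨-, h1⟩ := site_inj.1 h
  have h1' := congrArg (fun j : Fin L => patternSpin (j : ℕ)) h1
  simp only [patternSpin_upCoord, patternSpin_downCoord] at h1'
  exact absurd h1' (by decide)

/-- The two ends of a dimer are consecutive sites: `up ⋖ down` (even block) or `down ⋖ up` (odd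
block). [folklore] -/
theorem dimer_covBy (k : Fin L × Fin (L / 2)) :
    dimerUp k ⋖ dimerDown k ∨ dimerDown k ⋖ dimerUp k := by
  by_cases hb : (k.2 : ℕ) % 2 = 0
  · left
    refine site_covBy_site ?_
    rw [val_upCoord, val_downCoord, if_pos hb, if_pos hb]
  · right
    refine site_covBy_site ?_
    rw [val_upCoord, val_downCoord, if_neg hb, if_neg hb]

/-- The two ends of a dimer are nearest neighbours (a bond along `e₁`). [folklore] -/
theorem adj_dimerUp_dimerDown (k : Fin L × Fin (L / 2)) :
    (fermionTorusGraph 2 L).Adj (dimerUp k) (dimerDown k) := by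
  by_cases hb : (k.2 : ℕ) % 2 = 0
  · refine adj_site_succ ?_
    rw [val_upCoord, val_downCoord, if_pos hb, if_pos hb]
  · refine (adj_site_succ ?_).symm
    rw [val_upCoord, val_downCoord, if_neg hb, if_neg hb]

/-- The `d`-wave bond sign of a dimer is `-1` (its bond is along `e₁`). [folklore] -/
theorem dWaveBondSign_dimer (k : Fin L × Fin (L / 2)) :
    dWaveBondSign L (dimerUp k) (dimerDown k) = -1 := by
  have hne : ¬ ((upCoord k.2 : ℕ) = (downCoord k.2 : ℕ)) := by
    rw [val_upCoord, val_downCoord]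
    split_ifs <;> omega
  rw [dWaveBondSign, if_pos (adj_dimerUp_dimerDown k), if_neg]
  exact hne

/-- An orbital conforms to the reference pattern: its spin is the pattern spin of its line
coordinate. [folklore] -/
def IsPatternOrb (o : Orb (FermionTorus 2 L)) : Prop :=
  (ofLex o).2 = patternSpin (ofLex (ofLex o).1 1 : ℕ)

/-- Every orbital of a dimer configuration of the reference pattern conforms to it. [folklore] -/
theorem isPatternOrb_of_mem_dimerConfig {A : Finset (Fin L × Fin (L / 2))}
    {o : Orb (FermionTorus 2 L)} (ho : o ∈ dimerConfig dimerUp dimerDown A) : IsPatternOrb o := by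
  rcases orb_cases o with h | h <;> rw [h] at ho ⊢
  · obtain ⟨k, -, hk⟩ := orb_zero_mem_dimerConfig.1 ho
    rw [IsPatternOrb, ← hk]
    exact (patternSpin_upCoord k.2).symm
  · obtain ⟨k, -, hk⟩ := orb_one_mem_dimerConfig.1 ho
    rw [IsPatternOrb, ← hk]
    exact (patternSpin_downCoord k.2).symm

/-- The support invariant: inside the pattern, a down electron on line coordinate `1` is always
accompanied by the up electron on line coordinate `0` of the same line (its only possible
partner). [folklore] -/
def PatternInv (t : Finset (Orb (FermionTorus 2 L))) : Prop :=
  (∀ o ∈ t, IsPatternOrb o) → ∀ z : FermionTorus 2 L, (ofLex z 1 : ℕ) = 1 → orb z 1 ∈ t →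
    ∃ z' : FermionTorus 2 L, ofLex z' 0 = ofLex z 0 ∧ (ofLex z' 1 : ℕ) = 0 ∧ orb z' 0 ∈ t

/-- `(a + 1) mod L` for `a < L`: either `a + 1` or, at the wrap-around, `0`. [folklore] -/
theorem succ_mod_cases {a : ℕ} (ha : a < L) :
    ((a + 1) % L = a + 1 ∧ a + 1 < L) ∨ ((a + 1) % L = 0 ∧ a + 1 = L) := by
  rcases Nat.lt_or_ge (a + 1) L with h | h
  · exact Or.inl ⟨Nat.mod_eq_of_lt h, h⟩
  · have h' : a + 1 = L := by omega
    exact Or.inr ⟨by rw [h', Nat.mod_self], h'⟩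

/-- The support invariant is stable under adding a nearest-neighbour pair `{x↑, y↓}`. [folklore] -/
theorem patternInv_insert {t : Finset (Orb (FermionTorus 2 L))} {x y : FermionTorus 2 L}
    (ht : PatternInv t) (hc : dWaveBondSign L x y ≠ 0) :
    PatternInv (insert (orb x 0) (insert (orb y 1) t)) := by
  intro hpat z hz1 hz
  have hpat_t : ∀ o ∈ t, IsPatternOrb o := fun o ho =>
    hpat o (mem_insert_of_mem (mem_insert_of_mem ho))
  rcases mem_insert.1 hz with h | h
  · exact absurd (orb_inj.1 h).2 (by decide)
  rcases mem_insert.1 h with h | h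
  · -- the inserted down electron sits at `z = y = (i, 1)`: its partner must be `x = (i, 0)`
    have hyz : y = z := (orb_inj.1 h).1.symm
    subst hyz
    have hx : IsPatternOrb (orb x 0) := hpat _ (mem_insert_self _ _)
    have hx' : patternSpin (ofLex x 1 : ℕ) = 0 := by
      rw [IsPatternOrb] at hx
      simpa [orb] using hx.symm
    have hadj := adj_of_dWaveBondSign_ne_zero hc
    rw [← site_ofLex x, ← site_ofLex y] at hadj
    have hyL : 1 < L := by
      have := (ofLex y 1).isLt
      omega
    refine ⟨x, ?_, ?_, mem_insert_self _ _⟩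
    · rcases adj_site_cases hadj with hj | ⟨hi, -⟩
      · exfalso
        rw [hj, hz1, patternSpin] at hx'
        simp at hx'
      · exact hi
    · rcases adj_site_cases hadj with hj | ⟨-, hv | hv⟩
      · exfalso
        rw [hj, hz1, patternSpin] at hx'
        simp at hx'
      · rw [hz1] at hv
        rcases succ_mod_cases (ofLex x 1).isLt with ⟨h1, h2⟩ | ⟨h1, h2⟩
        · omega
        · omega
      · rw [hz1] at hv
        -- `x₁ = 2 mod L`: `x₁ = 0` if `L = 2`; otherwise `x₁ = 2` carries spin `↓`
        rcases Nat.lt_or_ge 2 L with hL2 | hL2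
        · have h2 : (1 + 1) % L = 2 := Nat.mod_eq_of_lt hL2
          rw [h2] at hv
          rw [hv, patternSpin] at hx'
          simp at hx'
        · have hL : L = 2 := by omega
          subst hL
          omega
  · obtain ⟨z', h0, h1, hm⟩ := ht hpat_t z hz1 h
    exact ⟨z', h0, h1, mem_insert_of_mem (mem_insert_of_mem hm)⟩

/-- **No cross terms for the reference pattern.** Removing from a dimer configuration a
nearest-neighbour pair `{x↑, y↓}` that is not one of its dimers leaves a configuration on which
every `B_d^n |0⟩` vanishes. (The only such pairs are `x = (i, 0)`, `y = (i, L - 1)` for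
`L ≡ 2 (mod 4)`, `L ≥ 6`, and the remaining configuration then contains the down electron at
`(i, 1)` without its only possible partner `(i, 0)↑`, violating `PatternInv`.) [folklore] -/
theorem dopedRVB_noCross (A : Finset (Fin L × Fin (L / 2))) (x y : FermionTorus 2 L)
    (hc : dWaveBondSign L x y ≠ 0) (hx : orb x 0 ∈ dimerConfig dimerUp dimerDown A)
    (hy : orb y 1 ∈ dimerConfig dimerUp dimerDown A)
    (hnot : ∀ k ∈ A, dimerUp k = x → dimerDown k ≠ y) (n : ℕ) :
    (geminalOp (dWaveBondSign L) ^ n *ᵥ vacuum)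
      (((dimerConfig dimerUp dimerDown A).erase (orb x 0)).erase (orb y 1)) = 0 := by
  obtain ⟨⟨i, b⟩, hkA, rfl⟩ := orb_zero_mem_dimerConfig.1 hx
  obtain ⟨⟨i', b'⟩, hk'A, rfl⟩ := orb_one_mem_dimerConfig.1 hy
  have hadj : (fermionTorusGraph 2 L).Adj (site i (upCoord b)) (site i' (downCoord b')) :=
    adj_of_dWaveBondSign_ne_zero hc
  have hU := val_upCoord_mod_four b
  have hD := val_downCoord_mod_four b'
  have hUv := val_upCoord b
  have hDv := val_downCoord b'
  -- if the pair is the dimer `(i, b)` itself we contradict `hnot`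
  have hdimer : i = i' → (b : ℕ) = b' → False := by
    rintro rfl hbb
    have hbb' : b = b' := Fin.ext hbb
    subst hbb'
    exact hnot (i, b) hkA rfl rfl
  rcases adj_site_cases hadj with hj | ⟨hii, hv | hv⟩
  · -- equal line coordinates: the two spins clash
    exfalso
    have hj' := congrArg Fin.val hj
    omega
  · -- `down = up + 1 mod L`
    exfalso
    rcases succ_mod_cases (upCoord b).isLt with ⟨h1, h2⟩ | ⟨h1, h2⟩
    · rw [h1] at hv
      refine hdimer hii ?_
      split_ifs at hUv hDv <;> omega
    · rw [h1] at hv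
      omega
  · -- `up = down + 1 mod L`
    rcases succ_mod_cases (downCoord b').isLt with ⟨h1, h2⟩ | ⟨h1, h2⟩
    · exfalso
      rw [h1] at hv
      refine hdimer hii ?_
      split_ifs at hUv hDv <;> omega
    · rw [h1] at hv
      -- unless `L = 2` (then the pair is the dimer), this is the genuine cross pair
      -- `x = (i, 0)`, `y = (i, L - 1)` with `L ≡ 2 (mod 4)`, `L ≥ 6`
      by_cases hL2 : (downCoord b' : ℕ) = (upCoord b : ℕ) + 1
      · exfalso
        refine hdimer hii ?_
        split_ifs at hUv hDv <;> omega
      subst hii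
      refine geminalOp_pow_mulVec_vacuum_apply_eq_zero (dWaveBondSign L) (P := PatternInv)
        (fun _ z _ hz => absurd hz (Finset.notMem_empty _))
        (fun t x y ht hc' _ _ => patternInv_insert ht hc') n _ fun hP => ?_
      -- the configuration is inside the pattern
      have hpat : ∀ o ∈ ((dimerConfig dimerUp dimerDown A).erase (orb (dimerUp (i, b)) 0)).erase
          (orb (dimerDown (i, b')) 1), IsPatternOrb o := fun o ho =>
        isPatternOrb_of_mem_dimerConfig (mem_of_mem_erase (mem_of_mem_erase ho))
      -- the down electron of the dimer `(i, b) = (i, 0)` sits at `(i, 1)` and survives the erasures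
      have hb1 : (downCoord b : ℕ) = 1 := by
        have hDb := val_downCoord b
        split_ifs at hUv hDb <;> omega
      have hmem : orb (dimerDown (i, b)) 1 ∈ ((dimerConfig dimerUp dimerDown A).erase
          (orb (dimerUp (i, b)) 0)).erase (orb (dimerDown (i, b')) 1) := by
        refine mem_erase.2 ⟨fun h => ?_, mem_erase.2 ⟨fun h => ?_, ?_⟩⟩
        · have h' : downCoord b = downCoord b' := (site_inj.1 (orb_inj.1 h).1).2
          have h'' := congrArg Fin.val h'
          omega
        · exact absurd (orb_inj.1 h).2 (by decide)
        · exact orb_one_mem_dimerConfig.2 ⟨(i, b), hkA, rfl⟩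
      obtain ⟨z', h0, h1, hm⟩ := hP hpat (dimerDown (i, b)) hb1 hmem
      -- but the only up orbital at `(i, 0)` is the erased one
      have hz' : z' = dimerUp (i, b) := by
        refine ext₂ ?_ (Fin.ext ?_)
        · simpa [dimerDown, dimerUp] using h0
        · rw [h1]
          show 0 = (upCoord b : ℕ)
          omega
      rw [hz'] at hm
      exact (notMem_erase _ _) (mem_of_mem_erase hm)

/-- The Jordan–Wigner sign of a dimer of the reference pattern: `+1` for even blocks (`up < down`),
`-1` for odd blocks. [folklore] -/
def dimerSign (k : Fin L × Fin (L / 2)) : ℂ := if (k.2 : ℕ) % 2 = 0 then 1 else -1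

/-- The dimer sign is `±1`, in particular nonzero. [folklore] -/
theorem dimerSign_ne_zero (k : Fin L × Fin (L / 2)) : dimerSign k ≠ 0 := by
  rw [dimerSign]; split_ifs <;> norm_num

/-- The sign hypothesis of `geminalOp_pow_mulVec_vacuum_dimerConfig` for the reference pattern.
[folklore] -/
theorem dopedRVB_sign (A : Finset (Fin L × Fin (L / 2))) (k : Fin L × Fin (L / 2)) (hk : k ∈ A) :
    jwSign (orb (dimerUp k) 0) ((dimerConfig dimerUp dimerDown A).erase (orb (dimerUp k) 0)) *
      jwSign (orb (dimerDown k) 1)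
        (((dimerConfig dimerUp dimerDown A).erase (orb (dimerUp k) 0)).erase (orb (dimerDown k) 1)) =
      dimerSign k := by
  have hxβ : dimerUp k ∉ A.image dimerDown := fun h => by
    obtain ⟨k', -, hk'⟩ := mem_image.1 h
    exact dimerUp_ne_dimerDown k k' hk'.symm
  have hyα : dimerDown k ∉ A.image dimerUp := fun h => by
    obtain ⟨k', -, hk'⟩ := mem_image.1 h
    exact dimerUp_ne_dimerDown k' k hk'
  refine (pairCreator_sign_of_covBy hxβ hyα (mem_image.2 ⟨k, hk, rfl⟩) (dimer_covBy k)).trans ?_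
  rw [dimerSign]
  by_cases hb : (k.2 : ℕ) % 2 = 0
  · have hlt : dimerUp k < dimerDown k :=
      (site_covBy_site (by rw [val_upCoord, val_downCoord, if_pos hb, if_pos hb])).lt
    rw [if_pos hlt, if_pos hb]
  · have hlt : dimerDown k < dimerUp k :=
      (site_covBy_site (by rw [val_upCoord, val_downCoord, if_neg hb, if_neg hb])).lt
    rw [if_neg (not_lt.2 hlt.le), if_neg hb]

/-- **The doped RVB state does not vanish** on even tori: for `L` even and `N ≤ L²`,
`P_G B_d^{⌊N/2⌋} |0⟩ ≠ 0` — its amplitude on a dimer–monomer configuration of the reference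
pattern is `±(⌊N/2⌋)!` (no cancellation). Anderson, Science 235 (1987) 1196; Sutherland, PRB 37
(1988) 3786, §II. [folklore] -/
theorem dopedRVBRaw_ne_zero {L N : ℕ} (hL : Even L) (hN : N ≤ L ^ 2) : dopedRVBRaw L N ≠ 0 := by
  have hcard : N / 2 ≤ Fintype.card (Fin L × Fin (L / 2)) := by
    rw [Fintype.card_prod, Fintype.card_fin, Fintype.card_fin]
    obtain ⟨a, rfl⟩ := hL
    have h2 : (a + a) / 2 = a := by omega
    have h4 : (a + a) ^ 2 = 2 * ((a + a) * a) := by ring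
    rw [h2]
    rw [h4] at hN
    generalize (a + a) * a = M at hN ⊢
    omega
  rw [dopedRVBRaw_eq_pow]
  exact gutzwillerProj_geminalOp_pow_mulVec_vacuum_ne_zero (dWaveBondSign L) dimerUp_injective
    dimerDown_injective dimerUp_ne_dimerDown dimerSign dopedRVB_sign dopedRVB_noCross
    (fun k => by rw [dWaveBondSign_dimer]; norm_num) dimerSign_ne_zero hcard

/-- The doped RVB state is nonzero on even tori for `N ≤ L²`. [folklore] -/
theorem dopedRVBState_ne_zero {L N : ℕ} (hL : Even L) (hN : N ≤ L ^ 2) : dopedRVBState L N ≠ 0 :=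
  fun h => dopedRVBRaw_ne_zero hL hN ((dopedRVBState_eq_zero_iff L N).1 h)

/-- **The doped RVB state is a unit vector** on even tori for `N ≤ L²` (in particular for the
route's `N_L = 2⌊(1-δ)L²/2⌋`, `δ ∈ (0, 1/2)`). [folklore] -/
theorem star_dopedRVBState_dotProduct_self_of_even {L N : ℕ} (hL : Even L) (hN : N ≤ L ^ 2) :
    star (dopedRVBState L N) ⬝ᵥ dopedRVBState L N = 1 :=
  star_dopedRVBState_dotProduct_self (dopedRVBRaw_ne_zero hL hN)

end TorusPattern

/-! ### The route's particle number `N_L = 2⌊(1-δ)L²/2⌋` -/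

/-- For `δ ≥ 0` the route's particle number `N_L = 2⌊(1-δ)L²/2⌋` does not exceed the number of
sites `L²`. [folklore] -/
theorem two_mul_natFloor_le_sq {δ : ℝ} (hδ : 0 ≤ δ) (L : ℕ) :
    2 * ⌊(1 - δ) * (L : ℝ) ^ 2 / 2⌋₊ ≤ L ^ 2 := by
  have h : ((2 * ⌊(1 - δ) * (L : ℝ) ^ 2 / 2⌋₊ : ℕ) : ℝ) ≤ ((L ^ 2 : ℕ) : ℝ) := by
    rcases le_or_gt ((1 - δ) * (L : ℝ) ^ 2 / 2) 0 with h0 | h0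
    · rw [Nat.floor_of_nonpos h0]
      push_cast
      positivity
    · have h1 := Nat.floor_le h0.le
      push_cast
      nlinarith [mul_nonneg hδ (sq_nonneg (L : ℝ))]
  exact_mod_cast h

/-- **The route's trial family is normalised**: for every `δ ≥ 0` and every even side `L`, the
state `χ_L = dopedRVBState L (2⌊(1-δ)L²/2⌋)` of `DopedRVBPairLRO` is a unit vector. [folklore] -/
theorem star_dopedRVBState_dotProduct_self_family {δ : ℝ} (hδ : 0 ≤ δ) {L : ℕ} (hL : Even L) :
    star (dopedRVBState L (2 * ⌊(1 - δ) * (L : ℝ) ^ 2 / 2⌋₊)) ⬝ᵥ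
      dopedRVBState L (2 * ⌊(1 - δ) * (L : ℝ) ^ 2 / 2⌋₊) = 1 :=
  star_dopedRVBState_dotProduct_self_of_even hL (two_mul_natFloor_le_sq hδ L)

/-- The route's trial family consists of even-particle-number states in the summit's sector
`szSector N_L 0`. [folklore] -/
theorem dopedRVBState_family_mem_szSector (δ : ℝ) (L : ℕ) :
    dopedRVBState L (2 * ⌊(1 - δ) * (L : ℝ) ^ 2 / 2⌋₊) ∈
      szSector (2 * ⌊(1 - δ) * (L : ℝ) ^ 2 / 2⌋₊) 0 :=
  dopedRVBState_mem_szSector (even_two_mul _)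

end Literature.MathematicalPhysics.QuantumLattice
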